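import Mathlib
import HarnessLib
import Literature.Analysis.FluidPDE.AncientMildCurlCompactness
import Literature.Analysis.FluidPDE.KNSSOseenMildDecayTools
import Literature.Analysis.FluidPDE.KNSSRegularityGalileanProofs
import Summits.NavierStokesRegularity.NavierStokesRegularity.Theorems.UnthreadedDoorCellFluxForwardVanishing

/-!
# Route `UnthreadedDoor` / `ThreadingFlux`, crux `PoloidalLiouville` (stmt-NavierStokesRegularity-1222), antidynamo v2 skeleton (sha16 `4ebf5683127b`),
# WALL `stub_scalarLiouville`: FAR FIELDS OF UNTHREADED FLOWS ARE FLAT-DIRECTION FLOWS (receding-centre compactness)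

Support file (seat leafhand-ns-unthreadeddoor-3 g30, cell decomp-ns), `--supports stmt-NavierStokesRegularity-1222 --as helper`; theorems only,
no definitions, no named facts.

The wall of the antidynamo skeleton is the crux itself (`stubScalarLiouville_iff_poloidalLiouville'`), i.e. a Liouville theorem for bounded
ancient flows whose vorticity is tangent to the spheres about one centre (in the mild vocabulary: about a continuous PATH of centres,
`poloidalLiouville_of_mild_movingCentre`).  Two LAND-ONLY hands (leafhand-3 g28/g29) recorded for the planners' RE-CUT that the FAR FIELD of such
a flow lies in the FLAT-DIRECTION class of the neighbouring crux ⟨19708⟩ `PoloidalWindowRigidity` («`⟪curl v, e⟫ ≡ 0` for a fixed `e ≠ 0`»), by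
the receding-axis compactness pattern of Lei–Zhang 2011 §4 Case 2 / Lei–Ren–Zhang 2019 Lemma 5.1 (tree: `Literature…AncientAxisymFarFieldFlattening`).
This file TYPES that bridge, unconditionally:

* §1 `translate_*` — space translates `w(t, · + y)` of a bounded continuous Oseen-mild ancient field with weakly divergence-free slices are again
  such fields (translation covariance of `e^{τΔ}` and of the Oseen–Duhamel operator, by name).
* §2 ★★ `exists_farField_limit_flatDirection` — **RECEDING-CENTRE COMPACTNESS.**  Let `w` be bounded, continuous, Oseen-mild on `(−∞,0)` with weakly
  divergence-free slices, and UNTHREADED ABOUT A MOVING CENTRE `p(t)` (`⟪y − p(t), curl w(t) y⟫ = 0`; no regularity of `p` is needed).  For every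
  sequence `y_k` with `‖y_k‖ → ∞` and `y_k/‖y_k‖ → e` there are a subsequence `φ` and a bounded continuous Oseen-mild ancient field `W` with `C^∞`
  slices and uniform derivative bounds (KNSS 2009 Lemma 6.1 + §4, tree `exists_ancientMild_limit_curl_tendsto`) such that
  `w(t, x + y_{φ j}) → W(t, x)`, `curl w(t)(x + y_{φ j}) → curl W(t)(x)` and **`⟪e, curl W(t) x⟫ = 0`** for all `t < 0`, `x`:
  divide `⟪x + y − p(t), curl w(t)(x + y)⟫ = 0` by `‖y‖` and pass to the limit.
* §3 ★ `exists_farField_limit_flatDirection_of_wall` — the same for the WALL'S OWN CLASS (bounded ancient mild in the duality sense, measurable slices,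
  jointly smooth, vorticity tangent to the spheres about a FIXED `x₀`), through the Oseen gauge `v(t) = w(t, · − A(t)) + c(t)`
  (`Theorems.oseen_gauge_of_aestronglyMeasurable`): the far-field limits of `v` along `y_k` are `W(t, · − A(t)) + c(t)` with `W` as in §2 and
  `⟪e, curl W(t)⟫ ≡ 0`.

So the far field of ⟨1222⟩ is governed by the bounded (not Type-I) flat-direction Liouville problem — the common open core of ⟨1222⟩ and ⟨19708⟩ —
and what remains near the centre is a separate «centred endgame».  HONEST LABEL: compactness bookkeeping on landed Literature theorems; no stub of
the skeleton is closed; the wall / crux ⟨1222⟩, the flat-direction Liouville theorem and ⟨19708⟩ stay OPEN; nothing here bears on Navier–Stokes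
regularity; no summit statement is proved.
[cite: KochNadirashviliSereginSverak2009, Lemma 6.1 and §4 (4.10) (arXiv:0709.3599 pp. 8, 11); LeiZhang2011, §4 Case 2 (arXiv:1011.5066 pp. 12–13);
LeiRenZhang2019, Lemma 5.1 (arXiv:1902.11229 p. 13)]
-/

noncomputable section

-- the summit and its single sub-problem share the name (CONVENTIONS §1)
set_option linter.dupNamespace false

open scoped Topology InnerProductSpace RealInnerProductSpace ContDiff
open Filter Set Function Metric MeasureTheory
open Literature.Analysis Literature.Analysis.FluidPDE Literature.Analysis.UnboundedOperators

namespace Summit.NavierStokesRegularity.NavierStokesRegularity.Theorems.PoloidalLiouville.FarField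

open Summit.NavierStokesRegularity.NavierStokesRegularity.Theorems.PoloidalLiouville.NetFlux (E3)

/-! ### §1 Space translates of bounded Oseen-mild ancient fields -/

/-- Continuity of a space translate on the open past slab. [folklore] -/
theorem translate_continuousOn {w : ℝ → E3 → E3} (hwc : ContinuousOn (uncurry w) (Iio (0 : ℝ) ×ˢ univ)) (y : E3) :
    ContinuousOn (uncurry fun t x => w t (x + y)) (Iio (0 : ℝ) ×ˢ univ) := by
  have hg : Continuous fun q : ℝ × E3 => (q.1, q.2 + y) := by fun_prop
  have hmaps : MapsTo (fun q : ℝ × E3 => (q.1, q.2 + y)) (Iio (0 : ℝ) ×ˢ univ) (Iio (0 : ℝ) ×ˢ univ) :=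
    fun q hq => ⟨hq.1, mem_univ _⟩
  exact hwc.comp hg.continuousOn hmaps

/-- The Oseen integral identity is translation covariant. [cite: KochNadirashviliSereginSverak2009, §4 (i) (arXiv:0709.3599 p. 8)] -/
theorem translate_oseenMild {w : ℝ → E3 → E3}
    (hwmild : ∀ s t : ℝ, s < t → t < 0 → ∀ x,
      w t x = heatExtension (w s) (t - s) x - oseenDuhamel 1 s w w t x)
    (y : E3) :
    ∀ s t : ℝ, s < t → t < 0 → ∀ x,
      (fun t x => w t (x + y)) t x =
        heatExtension ((fun t x => w t (x + y)) s) (t - s) x -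
          oseenDuhamel 1 s (fun t x => w t (x + y)) (fun t x => w t (x + y)) t x := by
  intro s t hst ht x
  simp only
  rw [heatExtension_comp_add_right_apply, oseenDuhamel_comp_add_right]
  exact hwmild s t hst ht (x + y)

/-! ### §2 Receding-centre compactness: far-field limits of unthreaded flows are flat-direction flows -/

/-- **The limit algebra.**  If `c j → L`, `‖y j‖ → ∞`, `‖y j‖⁻¹ • y j → e` and `⟪x + y j − p, c j⟫ = 0` for all `j`, then `⟪e, L⟫ = 0`. [folklore] -/
theorem inner_eq_zero_of_tendsto_receding {c y : ℕ → E3} {L e x p : E3}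
    (hc : Tendsto c atTop (𝓝 L)) (hy : Tendsto (fun j => ‖y j‖) atTop atTop)
    (he : Tendsto (fun j => ‖y j‖⁻¹ • y j) atTop (𝓝 e))
    (h0 : ∀ j, ⟪x + y j - p, c j⟫ = 0) : ⟪e, L⟫ = 0 := by
  -- `s j := ‖y j‖⁻¹ * ⟪x + y j − p, c j⟫ = ⟪‖y j‖⁻¹ • y j, c j⟫ + ‖y j‖⁻¹ * ⟪x − p, c j⟫` vanishes identically and tends to `⟪e, L⟫ + 0`
  have hs : ∀ j, ⟪‖y j‖⁻¹ • y j, c j⟫ + ‖y j‖⁻¹ * ⟪x - p, c j⟫ = 0 := fun j => by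
    rw [real_inner_smul_left, ← mul_add, ← inner_add_left]
    have e1 : y j + (x - p) = x + y j - p := by abel
    rw [e1, h0 j, mul_zero]
  have hinv : Tendsto (fun j => ‖y j‖⁻¹) atTop (𝓝 0) := tendsto_inv_atTop_zero.comp hy
  have h1 : Tendsto (fun j => ⟪‖y j‖⁻¹ • y j, c j⟫) atTop (𝓝 ⟪e, L⟫) := he.inner hc
  have h2 : Tendsto (fun j => ‖y j‖⁻¹ * ⟪x - p, c j⟫) atTop (𝓝 (0 * ⟪x - p, L⟫)) :=
    hinv.mul (tendsto_const_nhds.inner hc)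
  have hsum := h1.add h2
  rw [zero_mul, add_zero] at hsum
  have hzero : Tendsto (fun j => ⟪‖y j‖⁻¹ • y j, c j⟫ + ‖y j‖⁻¹ * ⟪x - p, c j⟫) atTop (𝓝 0) := by
    simp_rw [hs]; exact tendsto_const_nhds
  exact tendsto_nhds_unique hsum hzero

/-- ★★ **RECEDING-CENTRE COMPACTNESS: far fields of unthreaded bounded ancient Oseen-mild flows are FLAT-DIRECTION flows.**
Let `w` be continuous and bounded by `B` on `(−∞,0) × ℝ³`, Oseen-mild between negative times, with weakly divergence-free slices, and let its
vorticity be tangent at every `t < 0` to the spheres about a (completely arbitrary) moving centre `p t`.  Along every sequence `y_k → ∞` with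
`y_k/‖y_k‖ → e`, a subsequence of the translates `w(t, · + y_k)` converges pointwise together with its curls to a bounded continuous Oseen-mild
ancient field `W` with smooth slices, uniform derivative bounds, and `⟪e, curl W(t) x⟫ = 0` for all `t < 0`, `x`.
[cite: KochNadirashviliSereginSverak2009, Lemma 6.1 (arXiv:0709.3599 p. 11); LeiRenZhang2019, Lemma 5.1 (arXiv:1902.11229 p. 13)] -/
theorem exists_farField_limit_flatDirection {w : ℝ → E3 → E3} {B : ℝ} (p : ℝ → E3)
    (hwc : ContinuousOn (uncurry w) (Iio (0 : ℝ) ×ˢ univ))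
    (hwdiv : ∀ t < 0, IsWeaklyDivFree (w t))
    (hwmild : ∀ s t : ℝ, s < t → t < 0 → ∀ x,
      w t x = heatExtension (w s) (t - s) x - oseenDuhamel 1 s w w t x)
    (hwB : ∀ t < 0, ∀ x, ‖w t x‖ ≤ B)
    (hun : ∀ t < 0, ∀ x, ⟪x - p t, curl (w t) x⟫ = 0)
    {y : ℕ → E3} {e : E3} (hy : Tendsto (fun k => ‖y k‖) atTop atTop)
    (he : Tendsto (fun k => ‖y k‖⁻¹ • y k) atTop (𝓝 e)) :
    ∃ (φ : ℕ → ℕ) (W : ℝ → E3 → E3), StrictMono φ ∧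
      ContinuousOn (uncurry W) (Iio (0 : ℝ) ×ˢ univ) ∧
      (∀ t < 0, IsWeaklyDivFree (W t)) ∧
      (∀ t < 0, ∀ x, ‖W t x‖ ≤ B) ∧
      (∀ s t : ℝ, s < t → t < 0 → ∀ x,
        W t x = heatExtension (W s) (t - s) x - oseenDuhamel 1 s W W t x) ∧
      (∀ t < 0, ContDiff ℝ ∞ (W t)) ∧
      (∀ k : ℕ, ∃ K : ℝ, ∀ t < 0, ∀ x, ‖iteratedFDeriv ℝ k (W t) x‖ ≤ K) ∧
      (∀ t < 0, ∀ x, Tendsto (fun j => w t (x + y (φ j))) atTop (𝓝 (W t x))) ∧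
      (∀ t < 0, ∀ x, Tendsto (fun j => curl (w t) (x + y (φ j))) atTop (𝓝 (curl (W t) x))) ∧
      ∀ t < 0, ∀ x, ⟪e, curl (W t) x⟫ = 0 := by
  -- the translates, on the growing windows `(−k−1, 0)`
  set wk : ℕ → ℝ → E3 → E3 := fun k t x => w t (x + y k) with hwk
  have hA : Tendsto (fun k : ℕ => (-(k : ℝ) - 1)) atTop atBot :=
    tendsto_atBot_add_const_right _ (-1) (tendsto_neg_atTop_atBot.comp tendsto_natCast_atTop_atTop)
  have hcont : ∀ k : ℕ, ContinuousOn (uncurry (wk k)) (Ioo (-(k : ℝ) - 1) 0 ×ˢ univ) := fun k =>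
    (translate_continuousOn hwc (y k)).mono (prod_mono Ioo_subset_Iio_self le_rfl)
  have hdiv : ∀ k : ℕ, ∀ t ∈ Ioo (-(k : ℝ) - 1) 0, IsWeaklyDivFree (wk k t) := fun k t ht =>
    (hwdiv t ht.2).comp_add_right' (y k)
  have hmild : ∀ k : ℕ, ∀ s t : ℝ, -(k : ℝ) - 1 < s → s < t → t < 0 → ∀ x,
      wk k t x = heatExtension (wk k s) (t - s) x - oseenDuhamel 1 s (wk k) (wk k) t x :=
    fun k s t _ hst ht x => translate_oseenMild hwmild (y k) s t hst ht x
  have hbdd : ∀ k : ℕ, ∀ τ ∈ Ioo (-(k : ℝ) - 1) 0, ∀ x, ‖wk k τ x‖ ≤ B := fun k τ hτ x => hwB τ hτ.2 (x + y k)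
  obtain ⟨φ, W, hφ, hWc, hWdiv, hWB, hWmild, hWsm, hWK, hpt, hcurl⟩ :=
    exists_ancientMild_limit_curl_tendsto hA hcont hdiv hmild hbdd
  -- the curl of a translate is the translate of the curl
  have hcurl' : ∀ t < 0, ∀ x, Tendsto (fun j => curl (w t) (x + y (φ j))) atTop (𝓝 (curl (W t) x)) := by
    intro t ht x
    have h := hcurl t ht x
    have hrw : ∀ j, curl (wk (φ j) t) x = curl (w t) (x + y (φ j)) := fun j => by
      have := CellFlux.curl_comp_add_sub_const (w t) (y (φ j)) 0 x
      simpa [hwk] using this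
    simp_rw [hrw] at h
    exact h
  refine ⟨φ, W, hφ, hWc, hWdiv, hWB, hWmild, hWsm, hWK, fun t ht x => hpt t ht x, hcurl', fun t ht x => ?_⟩
  -- the limit algebra along the subsequence
  have hφt : Tendsto φ atTop atTop := hφ.tendsto_atTop
  exact inner_eq_zero_of_tendsto_receding (hcurl' t ht x) (hy.comp hφt) (he.comp hφt)
    fun j => hun t ht (x + y (φ j))

/-! ### §3 The wall's own class (duality-mild, fixed centre), through the Oseen gauge -/

/-- ★ **FAR FIELDS OF THE WALL'S CLASS ARE FLAT-DIRECTION FLOWS.**  For a bounded ancient mild solution in the duality sense with measurable slices,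
jointly smooth on the open slab, whose vorticity is tangent to the spheres about a fixed `x₀`, and any `y_k → ∞` with `y_k/‖y_k‖ → e`: in the
Oseen gauge `v(t) = w(t, · − A(t)) + c(t)` (`Theorems.oseen_gauge_of_aestronglyMeasurable`; `A` continuous) a subsequence of the translates
`v(t, · + y_k)` converges pointwise, with its curls, to `W(t, · − A(t)) + c(t)` where `W` is a bounded continuous Oseen-mild ancient field with smooth
slices, uniform derivative bounds and `⟪e, curl W(t)⟫ ≡ 0` (the bounded flat-direction class).
[cite: KochNadirashviliSereginSverak2009, §4 (i)–(ii), Lemma 6.1 (arXiv:0709.3599 pp. 8, 11); LeiRenZhang2019, Lemma 5.1 (arXiv:1902.11229 p. 13)] -/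
theorem exists_farField_limit_flatDirection_of_wall
    (v : ℝ → E3 → E3) (x₀ : E3)
    (hB : IsBoundedAncientMildSolution 1 v)
    (hm : ∀ t < 0, AEStronglyMeasurable (v t) volume)
    (hsm : ContDiffOn ℝ (⊤ : ℕ∞) (uncurry v) (Iio 0 ×ˢ univ))
    (hun : ∀ t < 0, ∀ x, ⟪x - x₀, curl (v t) x⟫ = 0)
    {y : ℕ → E3} {e : E3} (hy : Tendsto (fun k => ‖y k‖) atTop atTop)
    (he : Tendsto (fun k => ‖y k‖⁻¹ • y k) atTop (𝓝 e)) :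
    ∃ (φ : ℕ → ℕ) (W : ℝ → E3 → E3) (A c : ℝ → E3) (B : ℝ), StrictMono φ ∧ Continuous A ∧
      ContinuousOn (uncurry W) (Iio (0 : ℝ) ×ˢ univ) ∧
      (∀ t < 0, IsWeaklyDivFree (W t)) ∧
      (∀ t < 0, ∀ x, ‖W t x‖ ≤ B) ∧
      (∀ s t : ℝ, s < t → t < 0 → ∀ x,
        W t x = heatExtension (W s) (t - s) x - oseenDuhamel 1 s W W t x) ∧
      (∀ t < 0, ContDiff ℝ ∞ (W t)) ∧
      (∀ k : ℕ, ∃ K : ℝ, ∀ t < 0, ∀ x, ‖iteratedFDeriv ℝ k (W t) x‖ ≤ K) ∧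
      (∀ t < 0, ∀ x, Tendsto (fun j => v t (x + y (φ j))) atTop (𝓝 (W t (x - A t) + c t))) ∧
      (∀ t < 0, ∀ x, Tendsto (fun j => curl (v t) (x + y (φ j))) atTop (𝓝 (curl (W t) (x - A t)))) ∧
      ∀ t < 0, ∀ x, ⟪e, curl (W t) x⟫ = 0 := by
  -- ## the Oseen gauge, everywhere
  obtain ⟨w, A, c, -, hwc, ⟨K, hK⟩, hwdiv, hwmild, hA, hrep⟩ := Theorems.oseen_gauge_of_aestronglyMeasurable v hB hm
  have hrep' : ∀ s < 0, ∀ z, v s z = w s (z - A s) + c s :=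
    fun s hs z => CellFlux.galilean_rep_everywhere hsm.continuousOn hwc hrep hs z
  have hws : ∀ s < 0, w s = fun z => v s (z + A s) - c s := fun s hs => by
    funext z
    have h := hrep' s hs (z + A s)
    rw [add_sub_cancel_right] at h
    rw [h, add_sub_cancel_right]
  have hw_curl : ∀ s < 0, ∀ z, curl (w s) z = curl (v s) (z + A s) := fun s hs z => by
    rw [hws s hs, CellFlux.curl_comp_add_sub_const]
  -- ## the representative is unthreaded about the moving centre `x₀ − A t`
  have htan : ∀ t < 0, ∀ z, ⟪z - (x₀ - A t), curl (w t) z⟫ = 0 := fun t ht z => by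
    rw [hw_curl t ht]
    have h := hun t ht (z + A t)
    have e1 : z + A t - x₀ = z - (x₀ - A t) := by abel
    rwa [e1] at h
  -- ## receding-centre compactness for the representative
  obtain ⟨φ, W, hφ, hWc, hWdiv, hWB, hWmild, hWsm, hWK, hpt, hcurl, hflat⟩ :=
    exists_farField_limit_flatDirection (fun t => x₀ - A t) hwc hwdiv hwmild hK htan hy he
  refine ⟨φ, W, A, c, K, hφ, hA, hWc, hWdiv, hWB, hWmild, hWsm, hWK, fun t ht x => ?_, fun t ht x => ?_, hflat⟩
  · -- `v t (x + y_j) = w t (x − A t + y_j) + c t`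
    have hrw : ∀ j, v t (x + y (φ j)) = w t (x - A t + y (φ j)) + c t := fun j => by
      rw [hrep' t ht]
      congr 2
      abel
    simp_rw [hrw]
    exact (hpt t ht (x - A t)).add tendsto_const_nhds
  · have hrw : ∀ j, curl (v t) (x + y (φ j)) = curl (w t) (x - A t + y (φ j)) := fun j => by
      rw [hw_curl t ht]
      congr 1
      abel
    simp_rw [hrw]
    exact hcurl t ht (x - A t)

end Summit.NavierStokesRegularity.NavierStokesRegularity.Theorems.PoloidalLiouville.FarField

end
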